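import Literature.NumberTheory.GelbartRogawski1991.LocalLeraySection
import Literature.NumberTheory.GelbartRogawski1991.LocalSplittingConformallyIsometric
import Literature.RepresentationTheory.MoeglinVignerasWaldspurger1987.RankOneThetaLiftLinesDisjoint
import HarnessLib

/-!
# Rank-one theta lifts to `U(V)` from two skew-hermitian lines OF THE SAME CLASS are isomorphic: the local Weil
# representation of `U(J)(F_v)` depends on the line `ε` only through its class in `E_v^{−×}/Nm E_vˣ`
# (the (⇐) direction of the `ε`-clause of [Liu2021, Lem. D.1 (3)]) — THEOREMS ONLY

Topic `RepresentationTheory/MoeglinVignerasWaldspurger1987`; companion of `RankOneThetaLift.lean` (facts IV-1/IV-2),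
`RankOneThetaLiftLinesDisjoint.lean` (fact IV-4c1: lines of DIFFERENT classes give disjoint lifts) and
`RankOneThetaLiftTwistRigidity.lean` (fact IV-4c3), in the SAME SECTION CURRENCY (general rank `N`): a number field `F`,
`E/F` quadratic with `c`, TWO trace-zero elements `δ₁, δ₂ ≠ 0` (`c δᵢ = -δᵢ`, `δᵢ² = dᵢ`), ONE symmetric
`T ∈ GL_N(F)` with `J = T ⊗ 1`, a finite place `v`; the symplectic space `𝕎_v = F_vᴺ × F_vᴺ` with `alt (polar β_{𝕋_v})`,
its group `LocalSp F N T v`, the Schrödinger model `localSchrodinger F N T v` on `𝒮(F_vᴺ)` and the metaplectic-type group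
`LocalMp F N T v` are COMMON to the two lines; what depends on the line is the embedding
`iota F E c N hcδᵢ hδᵢ hdᵢ T hT hJ v : U(J)(F_v) →* LocalSp F N T v` (restriction of scalars of `E_vᴺ` in the
`F_v`-rational polarisation `F_vᴺ · 1 ⊕ F_vᴺ · δᵢ`).  Row IV-4(b) `weilRep_iso_of_isometry` of the Hodge/COR-CM interface
(B-plan/INTERFACE-BIV.md §IV-4 (b), 2026-08-28): an HONEST THEOREM, no named fact, no `sorry`.

AS PRINTED. [Liu2021, App. D §D.1 Step 1] (l. 5217): «`ε` ranges over `E^{−×}/Nm_{E/F} E^×`»; [Lemma D.1 (3)]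
(l. 5233): «If `n ≥ 3`, then `ω(μ', ε', χ')` is isomorphic to `ω(μ, ε, χ)` if and only if `(μ', ε', χ') = (μ, ε, χ)`.»
The (⇐) direction in `ε` — two representatives of the SAME class give isomorphic `ω(μ, ε, χ)` — is implicit in the
print (the datum is indexed by the class) and is the standard fact that the restriction of the Weil representation along
`U(V) × U(W) → Sp(V ⊗ W)` depends on the skew-hermitian space `W` only up to isometry: [MoeglinVignerasWaldspurger1987,
Chap. 1 I.16–I.17] (hermitian tensor products `W = W₁ ⊗ W₂` and dual pairs, «les structures hermitiennes … sont définies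
… à similitude près», held text chunk p0016), [Chap. 2 II.1 (A)–(B)] (the group `S̃p_ψ(W) ⊂ Sp(W) × GL(S)` of pairs
`(g, M)`, «M est unique à un scalaire près», chunk p0042) and [Chap. 2 II, Remarques (2)–(3)] («les groupes symplectiques
de `W` muni de `⟨,⟩` et de `W` muni de `a⟨,⟩` sont égaux»; `GSp(W)` acts on `H` and on `S̃p_ψ(W)` by conjugation, chunk
p0046); [HarrisKudlaSweet1996, §1]: an isometry of the symplectic data conjugates the embeddings `ι` and is implemented on
the model.  For the rank-one line `W_ε = (E_v, ε x yᶜ)`: `W_{ε₁} ≅ W_{ε₂}` iff `ε₂ = x xᶜ ε₁` for some `x ∈ E_vˣ`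
(`LemD1.SameClass`, READING L3′ of `Liu2021/LemD1AsPrinted.lean`), the isometry being `y ↦ x y`.

WHAT IS PROVED (all `N`, any finite `v`, split or not; nothing about irreducibility is used):
* §1 (coordinates, namespace `LineTransport`) `reImL` — the `F_v`-LINEAR coordinate map `E_vᴺ ≃ F_vᴺ × F_vᴺ` of the line
  `δ` (the tree's additive `QuadraticCoordinates.reIm`, upgraded); `transport x = reIm_{δ₂} ∘ (u ↦ x u) ∘ reIm_{δ₁}⁻¹`, an
  `F_v`-linear automorphism of `𝕎_v`; **`transport_mem_localSp`** — it is SYMPLECTIC when `δ₂ ⊗ 1 = x xᶜ (δ₁ ⊗ 1)`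
  (`im_{δ₂}(x xᶜ z) = im_{δ₁}(z)`, `im_mul_norm_mul`; `h(x u, x u') = xᶜ x h(u, u')`, `hermForm_mulL`); `transportSp` = it as
  an element `γ_x ∈ LocalSp F N T v`; **`iota_eq_conj_iota`** — `ι_{δ₂}(g) = γ_x ι_{δ₁}(g) γ_x⁻¹` (an `E_v`-linear `g`
  commutes with `u ↦ x u`);
* §2 (metaplectic cover; generic part in namespace `HeisenbergGroup`: `MpPsi.proj_conj_comp_apply`,
  `MpPsi.toOp_conj_equivariant` — conjugating `s : G →* S̃p_ψ` by `q = (γ, M)` conjugates `p ∘ s` by `γ` and `M`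
  intertwines `toRep ∘ s` with `toRep ∘ (q s q⁻¹)`) `lineTransportLift` — a CHOSEN lift `q_x = (γ_x, M_x) ∈ LocalMp F N T v`
  of `γ_x` (every element of `Sp(𝕎_v)` is implemented, tree `existsImplementer_localSchrodinger`); **`lineTransportSplitting
  s₁ := q_x s₁ q_x⁻¹`**, **`proj_lineTransportSplitting`** — it lies over `ι_{δ₂}` when `s₁` lies over `ι_{δ₁}`;
  `lineTransportOp = M_x`, **`lineTransportOp_equivariant`** — `M_x ω_{s₁}(g) = ω_{s₂}(g) M_x`
  (`ω_s := (MpPsi.toRep (localSchrodinger F N T v)).comp s`); `isSmooth_lineTransportSplitting` — smoothness passes;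
  `isL2Isometric_lineTransportSplitting` (§2b) — UNITARITY passes: `ω_{s₂}` is `L²(μ'ᴺ)`-isometric if `ω_{s₁}` is (`M_x` is
  conformal for `‖·‖_{L²}`, tree `exists_l2NormSq_toRep_comp_eq_mul`, [Weil1964, Chap. I n° 13]);
* §3 (generic, namespace `TwistedCoinv`) `exists_equivariant_of_equivariant`, `nontrivial_coinv_iff_of_equivariant` — an
  equivariant `M : ρV ≃ ρV'` descends to a `G`-equivariant `Coinv (ρV ∘ ζ) χ ≃ Coinv (ρV' ∘ ζ) χ` (tree `mapEquiv`);
* §4 (headline, currency of `RankOneThetaLift.lean`) `areIsomorphicRep_theta_of_equivariant` /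
  `nontrivial_thetaCoinv_iff_of_equivariant` (any `s₁, s₂` with an equivariant `M`), and **`areIsomorphicRep_theta_lineTransportSplitting`**,
  **`nontrivial_thetaCoinv_iff_lineTransportSplitting`**: for every hermitian line `J₁` and character `χ` of
  `U(J₁)(F_v) = E_v¹`, `Θ_{s₁}(χ) ≅ Θ_{s₂}(χ)` as representations of `U(J)(F_v)` (`AreIsomorphicRep`) and
  `Θ_{s₁}(χ) ≠ 0 ↔ Θ_{s₂}(χ) ≠ 0`, `s₂` the transported splitting; `sameClass_eps_iff_exists` — the hypothesis
  `δ₂ ⊗ 1 = x xᶜ (δ₁ ⊗ 1)` IS `LemD1.SameClass` of the Step-1 representatives `LemD1OfPlace.eps E v hδᵢ` (the negation of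
  the class hypothesis of `rankOne_theta_lines_disjoint`).

So, at fixed splitting type and fixed `χ`, the isomorphism class of `Θ_s(χ)` depends on the line only through its norm
class — the `ε`-part of the (⇐) direction of `LemD1_3AsPrintedI` for the consumer `HypD3` (whose remaining (⇐) input,
«the transported splitting `q_x s₁ q_x⁻¹` has the same Kudla type as the consumer's own splitting over `ι_{δ₂}`», is an
explicit-formula statement on the A-side; two splittings over the same `ι` differ by a character, tree
`MpPsi.exists_character_of_proj_eq`).  Nothing of the cited sources is asserted; HC_CM is NOT proved here and not
mentioned further.  Cell hodgecm-mathlib, interface row IV-4(b); seat B-typ01.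

## References
* [MoeglinVignerasWaldspurger1987] C. Mœglin, M.-F. Vignéras, J.-L. Waldspurger, *Correspondances de Howe sur un corps
  p-adique*, LNM 1291 (1987), doi:10.1007/bfb0082712 — Chap. 1 I.16–I.17 (chunk p0016); Chap. 2 II.1 (A)–(B) (chunk
  p0042), II Remarques (2)–(3) (chunk p0046), II.6; Chap. 3 I.1–I.3.
* [HarrisKudlaSweet1996] M. Harris, S. Kudla, W. J. Sweet, *Theta dichotomy for unitary groups*, J. AMS 9 (1996)
  941–1004 — §1.
* [Weil1964] A. Weil, *Sur certains groupes d'opérateurs unitaires*, Acta Math. 111 (1964) — Chap. I n° 13 (unitarity of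
  the implementing operators).
* [Liu2021] Y. Liu, Camb. J. Math. 9 (2021) = arXiv:2102.11518 — App. D §D.1 Step 1 (l. 5217), Lem. D.1 (3) (l. 5233).
-/

noncomputable section

namespace Literature.RepresentationTheory.MoeglinVignerasWaldspurger1987

open NumberField IsDedekindDomain
open scoped Matrix
open Literature.RepresentationTheory.HeisenbergGroup
open Literature.NumberTheory.GelbartRogawski1991.UnitaryDualPair.LocalSplitting
open Literature.NumberTheory.Automorphic
open Literature.NumberTheory.Automorphic.UnitaryGroup
open Literature.NumberTheory.Automorphic.Liu2021 (AreIsomorphicRep LemD1.SameClass LemD1OfPlace.eps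
  LemD1OfPlace.eps_mem_skew LemD1OfPlace.standingData)

/-! ## §1 Coordinates: the transport `reIm_{δ₂} ∘ (u ↦ x u) ∘ reIm_{δ₁}⁻¹` is symplectic and conjugates `ι_{δ₁}` to `ι_{δ₂}` -/

namespace LineTransport

variable {F : Type} [Field F] [NumberField F] (E : Type) [Field E] [NumberField E] [Algebra F E]
  [Algebra.IsQuadraticExtension F E] (v : HeightOneSpectrum (𝓞 F)) (c : E ≃ₐ[F] E) (N : ℕ)

/-- **the `F_v`-LINEAR coordinate map `E_vᴺ ≃ F_vᴺ × F_vᴺ` of the line `δ`**, `u ↦ (re ∘ u, im ∘ u)` for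
`u_i = re u_i + im u_i · δ` — the tree's additive `QuadraticCoordinates.reIm` at `Ψ_v = quadraticLocalEquiv E v c hcδ hδ`,
with `F_v`-linearity recorded (`re (a z) = a · re z`). [cite: MoeglinVignerasWaldspurger1987, Chap. 1 I.17] -/
def reImL {δ : E} (hcδ : c δ = -δ) (hδ : δ ≠ 0) {d : F} (hd : δ * δ = algebraMap F E d) :
    (Fin N → LocalRing E v) ≃ₗ[v.adicCompletion F] ((Fin N → v.adicCompletion F) × (Fin N → v.adicCompletion F)) where
  toFun := QuadraticCoordinates.reIm (quadraticLocalEquiv E v c hcδ hδ).toLinearEquiv.toAddEquiv (Fin N)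
  invFun := (QuadraticCoordinates.reIm (quadraticLocalEquiv E v c hcδ hδ).toLinearEquiv.toAddEquiv (Fin N)).symm
  left_inv u := (QuadraticCoordinates.reIm (quadraticLocalEquiv E v c hcδ hδ).toLinearEquiv.toAddEquiv (Fin N)).symm_apply_apply u
  right_inv p := (QuadraticCoordinates.reIm (quadraticLocalEquiv E v c hcδ hδ).toLinearEquiv.toAddEquiv (Fin N)).apply_symm_apply p
  map_add' u u' := map_add _ u u'
  map_smul' a u := by
    have h := isQuadraticCoordinates_local E v c hcδ hδ hd
    refine Prod.ext (funext fun i => ?_) (funext fun i => ?_)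
    · simp only [QuadraticCoordinates.reIm_apply_fst, RingHom.id_apply, Prod.smul_fst, Pi.smul_apply, smul_eq_mul]
      rw [Algebra.smul_def, algebraMap_localRing_eq, h.re_map_mul]
    · simp only [QuadraticCoordinates.reIm_apply_snd, RingHom.id_apply, Prod.smul_snd, Pi.smul_apply, smul_eq_mul]
      rw [Algebra.smul_def, algebraMap_localRing_eq, h.im_map_mul]

/-- `reImL` IS the tree's `reIm` on elements. [cite: MoeglinVignerasWaldspurger1987, Chap. 1 I.17] -/
@[simp] theorem reImL_apply {δ : E} (hcδ : c δ = -δ) (hδ : δ ≠ 0) {d : F} (hd : δ * δ = algebraMap F E d)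
    (u : Fin N → LocalRing E v) :
    reImL E v c N hcδ hδ hd u =
      QuadraticCoordinates.reIm (quadraticLocalEquiv E v c hcδ hδ).toLinearEquiv.toAddEquiv (Fin N) u := rfl

/-- **multiplication by a unit `x ∈ E_vˣ` on `E_vᴺ`**, an `F_v`-linear automorphism (the isometry `y ↦ x y` of the
rank-one lines `W_{ε₁} → W_{ε₂}`, `ε₂ = x xᶜ ε₁`, tensored with `V`). [cite: MoeglinVignerasWaldspurger1987, Chap. 3 I.1] -/
def mulL (x : (LocalRing E v)ˣ) : (Fin N → LocalRing E v) ≃ₗ[v.adicCompletion F] (Fin N → LocalRing E v) where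
  toFun u := fun i => (x : LocalRing E v) * u i
  invFun u := fun i => ((x⁻¹ : (LocalRing E v)ˣ) : LocalRing E v) * u i
  left_inv u := funext fun i => by simp only [← mul_assoc, Units.inv_mul, one_mul]
  right_inv u := funext fun i => by simp only [← mul_assoc, Units.mul_inv, one_mul]
  map_add' u u' := funext fun i => by simp only [Pi.add_apply, mul_add]
  map_smul' a u := funext fun i => by
    simp only [Pi.smul_apply, RingHom.id_apply, Algebra.smul_def, mul_left_comm]

omit [Algebra.IsQuadraticExtension F E] in
/-- formula. [cite: MoeglinVignerasWaldspurger1987, Chap. 3 I.1] -/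
@[simp] theorem mulL_apply (x : (LocalRing E v)ˣ) (u : Fin N → LocalRing E v) (i : Fin N) :
    mulL E v N x u i = (x : LocalRing E v) * u i := rfl

variable {δ₁ δ₂ : E} (hcδ₁ : c δ₁ = -δ₁) (hδ₁ : δ₁ ≠ 0) {d₁ : F} (hd₁ : δ₁ * δ₁ = algebraMap F E d₁)
  (hcδ₂ : c δ₂ = -δ₂) (hδ₂ : δ₂ ≠ 0) {d₂ : F} (hd₂ : δ₂ * δ₂ = algebraMap F E d₂)
  (x : (LocalRing E v)ˣ)

/-- **the transport `reIm_{δ₂} ∘ (u ↦ x u) ∘ reIm_{δ₁}⁻¹`**, an `F_v`-linear automorphism of `𝕎_v = F_vᴺ × F_vᴺ`.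
[cite: MoeglinVignerasWaldspurger1987, Chap. 3 I.1–I.3] -/
def transport : ((Fin N → v.adicCompletion F) × (Fin N → v.adicCompletion F)) ≃ₗ[v.adicCompletion F]
    ((Fin N → v.adicCompletion F) × (Fin N → v.adicCompletion F)) :=
  (reImL E v c N hcδ₁ hδ₁ hd₁).symm ≪≫ₗ mulL E v N x ≪≫ₗ reImL E v c N hcδ₂ hδ₂ hd₂

/-- **`transport (reIm_{δ₁} u) = reIm_{δ₂} (x u)`**. [cite: MoeglinVignerasWaldspurger1987, Chap. 3 I.1–I.3] -/
theorem transport_reIm (u : Fin N → LocalRing E v) :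
    transport E v c N hcδ₁ hδ₁ hd₁ hcδ₂ hδ₂ hd₂ x
        (QuadraticCoordinates.reIm (quadraticLocalEquiv E v c hcδ₁ hδ₁).toLinearEquiv.toAddEquiv (Fin N) u) =
      QuadraticCoordinates.reIm (quadraticLocalEquiv E v c hcδ₂ hδ₂).toLinearEquiv.toAddEquiv (Fin N)
        (mulL E v N x u) := by
  rw [transport, LinearEquiv.trans_apply, LinearEquiv.trans_apply, ← reImL_apply E v c N hcδ₁ hδ₁ hd₁,
    LinearEquiv.symm_apply_apply, reImL_apply]

include hcδ₁ hδ₁ in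
/-- `(c ⊗ 1)` is an involution of `E ⊗_F F_v` (in the coordinates of `quadraticLocalEquiv` it is `(a, b) ↦ (a, -b)`).
[cite: MoeglinVignerasWaldspurger1987, Chap. 1 I.17] -/
private theorem conjLocal_conjLocal' (z : LocalRing E v) : conjLocal E c v (conjLocal E c v z) = z := by
  obtain ⟨⟨a, b⟩, rfl⟩ := (quadraticLocalEquiv E v c hcδ₁ hδ₁).surjective z
  rw [conjLocal_quadraticLocalEquiv, conjLocal_quadraticLocalEquiv, neg_neg]

include hcδ₁ hδ₁ in
/-- an element of `E ⊗_F F_v` fixed by `c ⊗ 1` is in `ι_v(F_v)` (in coordinates `(a, b) ↦ (a, -b)` fixes `(a, b)` iff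
`2 b = 0`). [cite: MoeglinVignerasWaldspurger1987, Chap. 1 I.17] -/
private theorem exists_toLocalRing_eq_of_conj_eq {y : LocalRing E v} (hy : conjLocal E c v y = y) :
    ∃ r : v.adicCompletion F, toLocalRing E v r = y := by
  haveI : CharZero (v.adicCompletion F) := charZero_of_injective_algebraMap (algebraMap F _).injective
  obtain ⟨⟨a, b⟩, rfl⟩ := (quadraticLocalEquiv E v c hcδ₁ hδ₁).surjective y
  rw [conjLocal_quadraticLocalEquiv] at hy
  have hb : -b = b := congrArg Prod.snd ((quadraticLocalEquiv E v c hcδ₁ hδ₁).injective hy)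
  have hb0 : b = 0 := by
    have h2 : (2 : v.adicCompletion F) * b = 0 := by linear_combination -hb
    exact (mul_eq_zero.1 h2).resolve_left two_ne_zero
  exact ⟨a, by rw [quadraticLocalEquiv_apply, hb0, map_zero, zero_mul, add_zero]⟩

include hd₁ hd₂ in
/-- **`im_{δ₂}(x xᶜ · z) = im_{δ₁}(z)`** when `δ₂ ⊗ 1 = x xᶜ (δ₁ ⊗ 1)`: `x xᶜ = ι_v(r)` is `c`-fixed, and
`x xᶜ (ι_v a + ι_v b δ₁) = ι_v (r a) + ι_v b δ₂`. [cite: MoeglinVignerasWaldspurger1987, Chap. 3 I.1] -/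
theorem im_mul_norm_mul (hx : algebraMap E (LocalRing E v) δ₂ =
      (x : LocalRing E v) * conjLocal E c v x * algebraMap E (LocalRing E v) δ₁) (z : LocalRing E v) :
    QuadraticCoordinates.im (quadraticLocalEquiv E v c hcδ₂ hδ₂).toLinearEquiv.toAddEquiv
        ((x : LocalRing E v) * conjLocal E c v x * z) =
      QuadraticCoordinates.im (quadraticLocalEquiv E v c hcδ₁ hδ₁).toLinearEquiv.toAddEquiv z := by
  have h₁ := isQuadraticCoordinates_local E v c hcδ₁ hδ₁ hd₁
  have h₂ := isQuadraticCoordinates_local E v c hcδ₂ hδ₂ hd₂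
  have hfix : conjLocal E c v ((x : LocalRing E v) * conjLocal E c v x) = (x : LocalRing E v) * conjLocal E c v x := by
    rw [map_mul, conjLocal_conjLocal' E v c hcδ₁ hδ₁, mul_comm]
  obtain ⟨r, hr⟩ := exists_toLocalRing_eq_of_conj_eq E v c hcδ₁ hδ₁ hfix
  set Ψ₁ := (quadraticLocalEquiv E v c hcδ₁ hδ₁).toLinearEquiv.toAddEquiv
  conv_lhs => rw [← h₁.re_add_im z]
  rw [mul_add, ← mul_assoc, mul_right_comm _ (toLocalRing E v _) (algebraMap E (LocalRing E v) δ₁), ← hx, ← hr,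
    ← map_mul, mul_comm (algebraMap E (LocalRing E v) δ₂), h₂.im_eq]

omit [Algebra.IsQuadraticExtension F E] in
/-- **`h(x u, x u') = xᶜ x · h(u, u')`** for the hermitian pairing `h(u, u') = (uᶜ)ᵀ H u'` (sesquilinearity).
[cite: MoeglinVignerasWaldspurger1987, Chap. 1 I.17] -/
theorem hermForm_mulL (H : Matrix (Fin N) (Fin N) (LocalRing E v)) (u u' : Fin N → LocalRing E v) :
    hermForm (conjLocal E c v) H (mulL E v N x u) (mulL E v N x u') =
      conjLocal E c v x * (x : LocalRing E v) * hermForm (conjLocal E c v) H u u' := by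
  have e1 : (⇑(conjLocal E c v) ∘ (mulL E v N x u)) = conjLocal E c v x • (⇑(conjLocal E c v) ∘ u) := by
    funext i
    simp only [Function.comp_apply, mulL_apply, map_mul, Pi.smul_apply, smul_eq_mul]
  have e2 : (mulL E v N x u' : Fin N → LocalRing E v) = (x : LocalRing E v) • u' := by
    funext i
    simp only [mulL_apply, Pi.smul_apply, smul_eq_mul]
  rw [hermForm_apply, hermForm_apply, e1, e2, Matrix.mulVec_smul, smul_dotProduct, dotProduct_smul, smul_eq_mul,
    smul_eq_mul, mul_assoc]

variable (T : Matrix (Fin N) (Fin N) F) {J : Matrix (Fin N) (Fin N) E}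

/-- **the transport is SYMPLECTIC** for `alt (polar β_{𝕋_v})` when `δ₂ ⊗ 1 = x xᶜ (δ₁ ⊗ 1)`: with
`alt (polar β_{𝕋_v}) (reIm_δ u) (reIm_δ u') = im_δ h(u, u')` (tree `im_hermForm_map`),
`im_{δ₂} h(x u, x u') = im_{δ₂} (x xᶜ h(u, u')) = im_{δ₁} h(u, u')`. [cite: MoeglinVignerasWaldspurger1987, Chap. 3 I.1–I.3] -/
theorem transport_mem_localSp (hT : T.IsSymm) (hx : algebraMap E (LocalRing E v) δ₂ =
      (x : LocalRing E v) * conjLocal E c v x * algebraMap E (LocalRing E v) δ₁) :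
    transport E v c N hcδ₁ hδ₁ hd₁ hcδ₂ hδ₂ hd₂ x ∈ LocalSp F N T v := by
  have h₁ := isQuadraticCoordinates_local E v c hcδ₁ hδ₁ hd₁
  have h₂ := isQuadraticCoordinates_local E v c hcδ₂ hδ₂ hd₂
  have hσφ : ∀ a, conjLocal E c v (toLocalRing E v a) = toLocalRing E v a := conjLocal_toLocalRing c v
  have hσδ₁ : conjLocal E c v (algebraMap E (LocalRing E v) δ₁) = -algebraMap E (LocalRing E v) δ₁ := by
    rw [conjLocal_algebraMap, hcδ₁, map_neg]
  have hσδ₂ : conjLocal E c v (algebraMap E (LocalRing E v) δ₂) = -algebraMap E (LocalRing E v) δ₂ := by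
    rw [conjLocal_algebraMap, hcδ₂, map_neg]
  have hT' : (localGram F N T v).IsSymm := hT.map _
  show _ ∈ symplecticGroup (polar (localPairing F N T v))
  rw [symplecticGroup, Heisenberg.PseudoSymplectic.mem_isometries]
  intro p q
  obtain ⟨u, rfl⟩ := (reImL E v c N hcδ₁ hδ₁ hd₁).surjective p
  obtain ⟨u', rfl⟩ := (reImL E v c N hcδ₁ hδ₁ hd₁).surjective q
  rw [reImL_apply, reImL_apply, transport_reIm, transport_reIm,
    ← h₂.im_hermForm_map (Fin N) hT' hσφ hσδ₂, ← h₁.im_hermForm_map (Fin N) hT' hσφ hσδ₁, hermForm_mulL,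
    mul_comm (conjLocal E c v x) (x : LocalRing E v)]
  exact im_mul_norm_mul E v c hcδ₁ hδ₁ hd₁ hcδ₂ hδ₂ hd₂ x hx _

/-- **the transport as an element `γ_x` of `LocalSp F N T v = Sp(𝕎_v)`**. [cite: MoeglinVignerasWaldspurger1987, Chap. 3 I.1–I.3] -/
def transportSp (hT : T.IsSymm) (hx : algebraMap E (LocalRing E v) δ₂ =
      (x : LocalRing E v) * conjLocal E c v x * algebraMap E (LocalRing E v) δ₁) : LocalSp F N T v :=
  ⟨transport E v c N hcδ₁ hδ₁ hd₁ hcδ₂ hδ₂ hd₂ x, transport_mem_localSp E v c N hcδ₁ hδ₁ hd₁ hcδ₂ hδ₂ hd₂ x T hT hx⟩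

/-- underlying automorphism of `transportSp`. [cite: MoeglinVignerasWaldspurger1987, Chap. 3 I.1–I.3] -/
@[simp] theorem coe_transportSp (hT : T.IsSymm) (hx : algebraMap E (LocalRing E v) δ₂ =
      (x : LocalRing E v) * conjLocal E c v x * algebraMap E (LocalRing E v) δ₁) :
    ((transportSp E v c N hcδ₁ hδ₁ hd₁ hcδ₂ hδ₂ hd₂ x T hT hx : LocalSp F N T v) :
      ((Fin N → v.adicCompletion F) × (Fin N → v.adicCompletion F)) ≃ₗ[v.adicCompletion F]
        ((Fin N → v.adicCompletion F) × (Fin N → v.adicCompletion F))) =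
      transport E v c N hcδ₁ hδ₁ hd₁ hcδ₂ hδ₂ hd₂ x := rfl

/-- **`ι_δ(g) (reIm_δ u) = reIm_δ (g u)`** on the factor form `localPi` (tree `localToSymplectic_reIm` through
`localPiEquiv`). [cite: MoeglinVignerasWaldspurger1987, Chap. 1 I.17] -/
theorem iota_apply_reIm (hT : T.IsSymm) (hJ : J = T.map (algebraMap F E)) {δ : E} (hcδ : c δ = -δ) (hδ : δ ≠ 0)
    {d : F} (hd : δ * δ = algebraMap F E d) (g : localPi E c N J v) (u : Fin N → LocalRing E v) :
    ((iota F E c N hcδ hδ hd T hT hJ v g : LocalSp F N T v) :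
        ((Fin N → v.adicCompletion F) × (Fin N → v.adicCompletion F)) ≃ₗ[v.adicCompletion F]
          ((Fin N → v.adicCompletion F) × (Fin N → v.adicCompletion F)))
        (QuadraticCoordinates.reIm (quadraticLocalEquiv E v c hcδ hδ).toLinearEquiv.toAddEquiv (Fin N) u) =
      QuadraticCoordinates.reIm (quadraticLocalEquiv E v c hcδ hδ).toLinearEquiv.toAddEquiv (Fin N)
        (((localPiEquiv E c N J v g).1).val *ᵥ u) := by
  rw [iota_def]
  exact localToSymplectic_reIm E c N v hcδ hδ hd hT hJ (localPiEquiv E c N J v g) u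

/-- **`ι_{δ₂}(g) = γ_x ι_{δ₁}(g) γ_x⁻¹`**: the two embeddings `U(J)(F_v) → Sp(𝕎_v)` attached to lines of the same class are
conjugate by the transport (an `E_v`-linear `g` commutes with `u ↦ x u`).
[cite: MoeglinVignerasWaldspurger1987, Chap. 3 I.1–I.3; HarrisKudlaSweet1996, §1] -/
theorem iota_eq_conj_iota (hT : T.IsSymm) (hJ : J = T.map (algebraMap F E)) (hx : algebraMap E (LocalRing E v) δ₂ =
      (x : LocalRing E v) * conjLocal E c v x * algebraMap E (LocalRing E v) δ₁) (g : localPi E c N J v) :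
    iota F E c N hcδ₂ hδ₂ hd₂ T hT hJ v g =
      transportSp E v c N hcδ₁ hδ₁ hd₁ hcδ₂ hδ₂ hd₂ x T hT hx * iota F E c N hcδ₁ hδ₁ hd₁ T hT hJ v g *
        (transportSp E v c N hcδ₁ hδ₁ hd₁ hcδ₂ hδ₂ hd₂ x T hT hx)⁻¹ := by
  rw [eq_mul_inv_iff_mul_eq]
  apply Subtype.ext
  apply LinearEquiv.ext
  intro p
  obtain ⟨u, rfl⟩ := (reImL E v c N hcδ₁ hδ₁ hd₁).surjective p
  rw [Subgroup.coe_mul, Subgroup.coe_mul, LinearEquiv.mul_apply, LinearEquiv.mul_apply, reImL_apply, coe_transportSp,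
    transport_reIm, iota_apply_reIm, iota_apply_reIm, transport_reIm]
  congr 1
  funext i
  simp only [mulL_apply, Matrix.mulVec, dotProduct, Finset.mul_sum, mul_left_comm]

end LineTransport

end Literature.RepresentationTheory.MoeglinVignerasWaldspurger1987

/-! ## §2 The metaplectic cover (generic, any model `ρ`): conjugating a homomorphism `s : G →* S̃p_ψ` by `q = (γ, M)` -/

namespace Literature.RepresentationTheory.HeisenbergGroup

section ConjGeneric

variable {R : Type*} [CommRing R] [Invertible (2 : R)] {V : Type*} [AddCommGroup V] [Module R V]
  {B : V →ₗ[R] V →ₗ[R] R} {k : Type*} [Field k] {S : Type*} [AddCommGroup S] [Module k S]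
  (ρ : Representation k (Heisenberg B) S) {G : Type*} [Group G] (q : MpPsi ρ) (s : G →* MpPsi ρ)

/-- **conjugation `g ↦ q s(g) q⁻¹` of a homomorphism `s : G →* S̃p_ψ(W)` by an element `q`** (Mathlib `MulAut.conj`).
[cite: MoeglinVignerasWaldspurger1987, Chap. 2 II.1 (B)] -/
theorem MpPsi.conj_comp_apply (g : G) : ((MulAut.conj q).toMonoidHom.comp s) g = q * s g * q⁻¹ := rfl

/-- **`p(q s(g) q⁻¹) = p(q) p(s(g)) p(q)⁻¹`** in `Sp(W)`. [cite: MoeglinVignerasWaldspurger1987, Chap. 2 II.1 (B)] -/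
theorem MpPsi.proj_conj_comp_apply (g : G) :
    MpPsi.proj ρ (((MulAut.conj q).toMonoidHom.comp s) g) = MpPsi.proj ρ q * MpPsi.proj ρ (s g) * (MpPsi.proj ρ q)⁻¹ := by
  rw [MpPsi.conj_comp_apply, map_mul, map_mul, map_inv]

/-- **the operator `M` of `q = (γ, M) ∈ S̃p_ψ(W)` intertwines `ω_s = toRep ∘ s` with `ω_{q s q⁻¹}`**:
`M ω_s(g) = ω_{q s q⁻¹}(g) M` (`toRep` is a homomorphism with operator component `toOp`).
[cite: MoeglinVignerasWaldspurger1987, Chap. 2 II.1 (A)–(B)] -/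
theorem MpPsi.toOp_conj_equivariant (g : G) (f : S) :
    MpPsi.toOp ρ q (((MpPsi.toRep ρ).comp s) g f) =
      ((MpPsi.toRep ρ).comp ((MulAut.conj q).toMonoidHom.comp s)) g (MpPsi.toOp ρ q f) := by
  show MpPsi.toRep ρ q (MpPsi.toRep ρ (s g) f) = MpPsi.toRep ρ (q * s g * q⁻¹) (MpPsi.toRep ρ q f)
  rw [← Module.End.mul_apply, ← map_mul, ← Module.End.mul_apply, ← map_mul, inv_mul_cancel_right]

end ConjGeneric

end Literature.RepresentationTheory.HeisenbergGroup

namespace Literature.RepresentationTheory.MoeglinVignerasWaldspurger1987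

open NumberField IsDedekindDomain
open scoped Matrix ENNReal
open _root_.MeasureTheory
open Literature.RepresentationTheory.HeisenbergGroup
open Literature.NumberTheory.GelbartRogawski1991.UnitaryDualPair.LocalSplitting
open Literature.NumberTheory.Automorphic
open Literature.NumberTheory.Automorphic.UnitaryGroup

section Metaplectic

variable {F : Type} [Field F] [NumberField F] (E : Type) [Field E] [NumberField E] [Algebra F E]
  [Algebra.IsQuadraticExtension F E] (v : HeightOneSpectrum (𝓞 F)) (c : E ≃ₐ[F] E) (N : ℕ)
  {δ₁ δ₂ : E} (hcδ₁ : c δ₁ = -δ₁) (hδ₁ : δ₁ ≠ 0) {d₁ : F} (hd₁ : δ₁ * δ₁ = algebraMap F E d₁)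
  (hcδ₂ : c δ₂ = -δ₂) (hδ₂ : δ₂ ≠ 0) {d₂ : F} (hd₂ : δ₂ * δ₂ = algebraMap F E d₂) (x : (LocalRing E v)ˣ)
  (T : Matrix (Fin N) (Fin N) F) (hT : T.IsSymm) (hTd : IsUnit T.det) {J : Matrix (Fin N) (Fin N) E}
  (hJ : J = T.map (algebraMap F E))
  (hx : algebraMap E (LocalRing E v) δ₂ = (x : LocalRing E v) * conjLocal E c v x * algebraMap E (LocalRing E v) δ₁)

/-- **a lift `q_x = (γ_x, M_x) ∈ S̃p_{ψ_v}(𝕎_v) = LocalMp F N T v` of the transport `γ_x`** — every element of `Sp(𝕎_v)` is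
implemented on `𝒮(F_vᴺ)` (tree `existsImplementer_localSchrodinger`, [MoeglinVignerasWaldspurger1987, Chap. 2 II.1 (A),
II.6]); a CHOICE (any two lifts differ by a scalar, II.1 (B)). [cite: MoeglinVignerasWaldspurger1987, Chap. 2 II.1 (A)–(B), II.6] -/
def lineTransportLift : LocalMp F N T v :=
  Classical.choose (MpPsi.proj_surjective _ (existsImplementer_localSchrodinger F N T hTd v)
    (LineTransport.transportSp E v c N hcδ₁ hδ₁ hd₁ hcδ₂ hδ₂ hd₂ x T hT hx))

/-- `p(q_x) = γ_x`. [cite: MoeglinVignerasWaldspurger1987, Chap. 2 II.1 (B)] -/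
theorem proj_lineTransportLift :
    MpPsi.proj (localSchrodinger F N T v) (lineTransportLift E v c N hcδ₁ hδ₁ hd₁ hcδ₂ hδ₂ hd₂ x T hT hTd hx) =
      LineTransport.transportSp E v c N hcδ₁ hδ₁ hd₁ hcδ₂ hδ₂ hd₂ x T hT hx :=
  Classical.choose_spec (MpPsi.proj_surjective _ (existsImplementer_localSchrodinger F N T hTd v)
    (LineTransport.transportSp E v c N hcδ₁ hδ₁ hd₁ hcδ₂ hδ₂ hd₂ x T hT hx))

/-- **the TRANSPORTED SPLITTING `s₂ := q_x s₁ q_x⁻¹ : U(J)(F_v) →* LocalMp F N T v`** of a homomorphism `s₁` (meant: a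
splitting over `ι_{δ₁}`). [cite: MoeglinVignerasWaldspurger1987, Chap. 2 II.1 (B); Chap. 3 I.1–I.3] -/
def lineTransportSplitting (s₁ : localPi E c N J v →* LocalMp F N T v) : localPi E c N J v →* LocalMp F N T v :=
  (MulAut.conj (lineTransportLift E v c N hcδ₁ hδ₁ hd₁ hcδ₂ hδ₂ hd₂ x T hT hTd hx)).toMonoidHom.comp s₁

/-- formula: `s₂(g) = q_x s₁(g) q_x⁻¹`. [cite: MoeglinVignerasWaldspurger1987, Chap. 2 II.1 (B)] -/
theorem lineTransportSplitting_apply (s₁ : localPi E c N J v →* LocalMp F N T v) (g : localPi E c N J v) :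
    lineTransportSplitting E v c N hcδ₁ hδ₁ hd₁ hcδ₂ hδ₂ hd₂ x T hT hTd hx s₁ g =
      lineTransportLift E v c N hcδ₁ hδ₁ hd₁ hcδ₂ hδ₂ hd₂ x T hT hTd hx * s₁ g *
        (lineTransportLift E v c N hcδ₁ hδ₁ hd₁ hcδ₂ hδ₂ hd₂ x T hT hTd hx)⁻¹ := rfl

/-- **the transported splitting lies over `ι_{δ₂}` when `s₁` lies over `ι_{δ₁}`**:
`p(q_x s₁(g) q_x⁻¹) = γ_x ι_{δ₁}(g) γ_x⁻¹ = ι_{δ₂}(g)` (`LineTransport.iota_eq_conj_iota`).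
[cite: MoeglinVignerasWaldspurger1987, Chap. 2 II.1 (B); Chap. 3 I.1–I.3; HarrisKudlaSweet1996, §1] -/
theorem proj_lineTransportSplitting (s₁ : localPi E c N J v →* LocalMp F N T v)
    (hs₁ : ∀ g, MpPsi.proj (localSchrodinger F N T v) (s₁ g) = iota F E c N hcδ₁ hδ₁ hd₁ T hT hJ v g)
    (g : localPi E c N J v) :
    MpPsi.proj (localSchrodinger F N T v) (lineTransportSplitting E v c N hcδ₁ hδ₁ hd₁ hcδ₂ hδ₂ hd₂ x T hT hTd hx s₁ g) =
      iota F E c N hcδ₂ hδ₂ hd₂ T hT hJ v g := by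
  rw [lineTransportSplitting, MpPsi.proj_conj_comp_apply, proj_lineTransportLift, hs₁]
  exact (LineTransport.iota_eq_conj_iota E v c N hcδ₁ hδ₁ hd₁ hcδ₂ hδ₂ hd₂ x T hT hJ hx g).symm

/-- **the operator `M_x` of the lift `q_x = (γ_x, M_x)`**, a linear automorphism of `𝒮(F_vᴺ)`.
[cite: MoeglinVignerasWaldspurger1987, Chap. 2 II.1 (A)] -/
def lineTransportOp : SchwartzBruhat (Fin N → v.adicCompletion F) ≃ₗ[ℂ] SchwartzBruhat (Fin N → v.adicCompletion F) :=
  MpPsi.toOp (localSchrodinger F N T v) (lineTransportLift E v c N hcδ₁ hδ₁ hd₁ hcδ₂ hδ₂ hd₂ x T hT hTd hx)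

/-- **`M_x` is `U(J)(F_v)`-EQUIVARIANT from `ω_{s₁}` to `ω_{s₂}`**, `s₂` the transported splitting,
`ω_s := (MpPsi.toRep (localSchrodinger F N T v)).comp s`: `M_x ω_{s₁}(g) = ω_{s₂}(g) M_x`.
[cite: MoeglinVignerasWaldspurger1987, Chap. 2 II.1 (A)–(B); Chap. 3 I.1–I.3] -/
theorem lineTransportOp_equivariant (s₁ : localPi E c N J v →* LocalMp F N T v) (g : localPi E c N J v)
    (Φ : SchwartzBruhat (Fin N → v.adicCompletion F)) :
    lineTransportOp E v c N hcδ₁ hδ₁ hd₁ hcδ₂ hδ₂ hd₂ x T hT hTd hx (((MpPsi.toRep (localSchrodinger F N T v)).comp s₁) g Φ) =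
      ((MpPsi.toRep (localSchrodinger F N T v)).comp
        (lineTransportSplitting E v c N hcδ₁ hδ₁ hd₁ hcδ₂ hδ₂ hd₂ x T hT hTd hx s₁)) g
        (lineTransportOp E v c N hcδ₁ hδ₁ hd₁ hcδ₂ hδ₂ hd₂ x T hT hTd hx Φ) :=
  MpPsi.toOp_conj_equivariant (localSchrodinger F N T v) _ s₁ g Φ

/-- **smoothness passes to the transported splitting**: `ω_{s₂}` is smooth if `ω_{s₁}` is (equivariant isomorphism,
tree `Representation.IsSmooth.of_equivariant`). [cite: MoeglinVignerasWaldspurger1987, Chap. 2 II.8] -/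
theorem isSmooth_lineTransportSplitting (s₁ : localPi E c N J v →* LocalMp F N T v)
    (hsm₁ : Representation.IsSmooth ((MpPsi.toRep (localSchrodinger F N T v)).comp s₁)) :
    Representation.IsSmooth ((MpPsi.toRep (localSchrodinger F N T v)).comp
      (lineTransportSplitting E v c N hcδ₁ hδ₁ hd₁ hcδ₂ hδ₂ hd₂ x T hT hTd hx s₁)) :=
  Representation.IsSmooth.of_equivariant _ (lineTransportOp E v c N hcδ₁ hδ₁ hd₁ hcδ₂ hδ₂ hd₂ x T hT hTd hx)
    (lineTransportOp_equivariant E v c N hcδ₁ hδ₁ hd₁ hcδ₂ hδ₂ hd₂ x T hT hTd hx s₁) hsm₁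

/-! ### §2b Unitarity passes to the transported splitting -/

/-- **`ω_{s₂}` is `L²(μ'ᴺ)`-ISOMETRIC if `ω_{s₁}` is**, `s₂` the transported splitting: `ω_{s₂}(g) = M_x ω_{s₁}(g) M_x⁻¹` and
the operator `M_x` of an element of `S̃p_{ψ_v}(𝕎_v)` is CONFORMAL for `‖·‖_{L²(μ'ᴺ)}` (a scalar multiple of an
`L²`-isometric implementer, tree `exists_l2NormSq_toRep_comp_eq_mul` / `exists_isometric_implementer_localSchrodinger`,
[Weil1964, Chap. I n° 13]; [MoeglinVignerasWaldspurger1987, Chap. 2 II.1 (A)]) — so the unitarity hypotheses of the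
split-place fact `rankOne_theta_twist_rigidity_split` hold for line-transported unitary splittings.
[cite: MoeglinVignerasWaldspurger1987, Chap. 2 II.1 (A); Weil1964, Chap. I n° 13] -/
theorem isL2Isometric_lineTransportSplitting [MeasurableSpace (v.adicCompletion F)] [BorelSpace (v.adicCompletion F)]
    (μ' : Measure (v.adicCompletion F)) [μ'.IsAddHaarMeasure] (s₁ : localPi E c N J v →* LocalMp F N T v)
    (h₁ : Representation.IsL2Isometric (Measure.pi fun _ : Fin N => μ') ((MpPsi.toRep (localSchrodinger F N T v)).comp s₁)) :
    Representation.IsL2Isometric (Measure.pi fun _ : Fin N => μ') ((MpPsi.toRep (localSchrodinger F N T v)).comp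
      (lineTransportSplitting E v c N hcδ₁ hδ₁ hd₁ hcδ₂ hδ₂ hd₂ x T hT hTd hx s₁)) := by
  intro g Φ
  -- the operator `M_x` is conformal with some constant `K`
  obtain ⟨K, -, -, hK⟩ := exists_l2NormSq_toRep_comp_eq_mul (hTd := hTd) μ' (MonoidHom.id (LocalMp F N T v))
    (lineTransportLift E v c N hcδ₁ hδ₁ hd₁ hcδ₂ hδ₂ hd₂ x T hT hTd hx)
  have hK' : ∀ Ψ : SchwartzBruhat (Fin N → v.adicCompletion F),
      SchwartzBruhat.l2NormSq (Measure.pi fun _ : Fin N => μ')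
          (lineTransportOp E v c N hcδ₁ hδ₁ hd₁ hcδ₂ hδ₂ hd₂ x T hT hTd hx Ψ) =
        K * SchwartzBruhat.l2NormSq (Measure.pi fun _ : Fin N => μ') Ψ := fun Ψ => by
    rw [← hK Ψ, MonoidHom.comp_id]
    rfl
  -- `ω_{s₂}(g) Φ = M_x (ω_{s₁}(g) (M_x⁻¹ Φ))`
  have e1 : ((MpPsi.toRep (localSchrodinger F N T v)).comp
        (lineTransportSplitting E v c N hcδ₁ hδ₁ hd₁ hcδ₂ hδ₂ hd₂ x T hT hTd hx s₁)) g Φ =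
      lineTransportOp E v c N hcδ₁ hδ₁ hd₁ hcδ₂ hδ₂ hd₂ x T hT hTd hx
        (((MpPsi.toRep (localSchrodinger F N T v)).comp s₁) g
          ((lineTransportOp E v c N hcδ₁ hδ₁ hd₁ hcδ₂ hδ₂ hd₂ x T hT hTd hx).symm Φ)) := by
    have h := lineTransportOp_equivariant E v c N hcδ₁ hδ₁ hd₁ hcδ₂ hδ₂ hd₂ x T hT hTd hx s₁ g
      ((lineTransportOp E v c N hcδ₁ hδ₁ hd₁ hcδ₂ hδ₂ hd₂ x T hT hTd hx).symm Φ)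
    rw [LinearEquiv.apply_symm_apply] at h
    exact h.symm
  rw [e1, hK', h₁ g]
  conv_rhs => rw [← (lineTransportOp E v c N hcδ₁ hδ₁ hd₁ hcδ₂ hδ₂ hd₂ x T hT hTd hx).apply_symm_apply Φ]
  rw [hK']

end Metaplectic

end Literature.RepresentationTheory.MoeglinVignerasWaldspurger1987

/-! ## §3 Theta lifts along an equivariant isomorphism (generic): `Θ_{s₁}(χ) ≅ Θ_{s₂}(χ)` -/

namespace Literature.RepresentationTheory.TwistedCoinv

variable {k : Type*} [CommRing k] {G H S S' : Type*} [Group G] [Group H] [AddCommGroup S] [Module k S]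
  [AddCommGroup S'] [Module k S'] (ρV : Representation k G S) (ρV' : Representation k G S') (ζ : H →* G) (χ : H →* kˣ)
  (hc : ∀ (g : G) (h : H), Commute (ρV g) ((ρV.comp ζ) h)) (hc' : ∀ (g : G) (h : H), Commute (ρV' g) ((ρV'.comp ζ) h))
  (M : S ≃ₗ[k] S')

/-- **an equivariant `M : ρV ≃ ρV'` descends to the `χ`-coinvariants under `H → G`**: `M` intertwines `ρV ∘ ζ` with
`ρV' ∘ ζ`, so `mapEquiv` (twist `1`) is a `G`-equivariant linear equivalence `Coinv (ρV ∘ ζ) χ ≃ Coinv (ρV' ∘ ζ) χ` of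
the coinvariant representations (`mapEquiv_rep`). [cite: MoeglinVignerasWaldspurger1987, Chap. 3 IV.4; Liu2021, App. D Lemma D.1 (3) (l. 5233)] -/
theorem exists_equivariant_of_equivariant (hM : ∀ (g : G) (v : S), M (ρV g v) = ρV' g (M v)) :
    ∃ f : Coinv (ρV.comp ζ) χ ≃ₗ[k] Coinv (ρV'.comp ζ) χ,
      ∀ (g : G) (x : Coinv (ρV.comp ζ) χ), f (rep χ ρV hc g x) = rep χ ρV' hc' g (f x) := by
  have hT : ∀ (h : H) (v : S), (ρV'.comp ζ) h (M v) = (((fun _ => 1 : H → kˣ) h : kˣ) : k) • M ((ρV.comp ζ) h v) :=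
    fun h v => by rw [Units.val_one, one_smul, MonoidHom.comp_apply, MonoidHom.comp_apply, hM]
  refine ⟨mapEquiv (ρV.comp ζ) χ (ρV'.comp ζ) χ M (fun _ => 1) hT (fun h => (one_mul _).symm), fun g x => ?_⟩
  rw [mapEquiv_rep (ρV.comp ζ) χ (ρV'.comp ζ) χ ρV ρV' hc hc' M (fun _ => 1) hT (fun h => (one_mul _).symm)
    (g := g) (g' := g) (a := (1 : k)) (fun v => by rw [one_smul, hM]), one_smul]

/-- **`Coinv (ρV ∘ ζ) χ ≠ 0 ↔ Coinv (ρV' ∘ ζ) χ ≠ 0`** along an equivariant `M : ρV ≃ ρV'`.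
[cite: MoeglinVignerasWaldspurger1987, Chap. 3 IV.2] -/
theorem nontrivial_coinv_iff_of_equivariant (hM : ∀ (g : G) (v : S), M (ρV g v) = ρV' g (M v)) :
    Nontrivial (Coinv (ρV.comp ζ) χ) ↔ Nontrivial (Coinv (ρV'.comp ζ) χ) :=
  (mapEquiv (ρV.comp ζ) χ (ρV'.comp ζ) χ M (fun _ => 1)
    (fun h v => by rw [Units.val_one, one_smul, MonoidHom.comp_apply, MonoidHom.comp_apply, hM])
    (fun h => (one_mul _).symm)).toEquiv.nontrivial_congr

end Literature.RepresentationTheory.TwistedCoinv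

namespace Literature.RepresentationTheory.MoeglinVignerasWaldspurger1987

open NumberField IsDedekindDomain
open scoped Matrix
open Literature.RepresentationTheory.HeisenbergGroup
open Literature.NumberTheory.GelbartRogawski1991.UnitaryDualPair.LocalSplitting
open Literature.NumberTheory.Automorphic
open Literature.NumberTheory.Automorphic.UnitaryGroup
open Literature.NumberTheory.Automorphic.Liu2021 (AreIsomorphicRep LemD1.SameClass LemD1OfPlace.eps
  LemD1OfPlace.eps_mem_skew LemD1OfPlace.standingData)

/-! ## §4 THE HEADLINE at two lines of the same class, in the currency of `RankOneThetaLift.lean`, and the consumer glue -/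

section Headline

variable {F : Type} [Field F] [NumberField F] (E : Type) [Field E] [NumberField E] [Algebra F E]
  [Algebra.IsQuadraticExtension F E] (v : HeightOneSpectrum (𝓞 F)) (c : E ≃ₐ[F] E) (N : ℕ)
  {δ₁ δ₂ : E} (hcδ₁ : c δ₁ = -δ₁) (hδ₁ : δ₁ ≠ 0) {d₁ : F} (hd₁ : δ₁ * δ₁ = algebraMap F E d₁)
  (hcδ₂ : c δ₂ = -δ₂) (hδ₂ : δ₂ ≠ 0) {d₂ : F} (hd₂ : δ₂ * δ₂ = algebraMap F E d₂)
  (T : Matrix (Fin N) (Fin N) F) (hT : T.IsSymm) (hTd : IsUnit T.det) {J : Matrix (Fin N) (Fin N) E}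
  (hJ : J = T.map (algebraMap F E))

omit [Algebra.IsQuadraticExtension F E] in
/-- **an equivariant `M : ω_{s₁} ≃ ω_{s₂}` gives `Θ_{s₁}(χ) ≅ Θ_{s₂}(χ)`** as representations of `U(J)(F_v)`
(`AreIsomorphicRep`), for every hermitian line `J₁` and character `χ` of `U(J₁)(F_v)` — the instantiation of
`TwistedCoinv.exists_equivariant_of_equivariant` at `ω_{sᵢ} = (MpPsi.toRep (localSchrodinger F N T v)).comp sᵢ` and the
centre `UnitaryGroup.localCenter`, in the currency of `mvw_IV4_rankOne_irreducibleOrZero`.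
[cite: MoeglinVignerasWaldspurger1987, Chap. 3 I.1–I.3, IV.4] -/
theorem areIsomorphicRep_theta_of_equivariant (s₁ s₂ : localPi E c N J v →* LocalMp F N T v)
    (M : SchwartzBruhat (Fin N → v.adicCompletion F) ≃ₗ[ℂ] SchwartzBruhat (Fin N → v.adicCompletion F))
    (hM : ∀ g Φ, M (((MpPsi.toRep (localSchrodinger F N T v)).comp s₁) g Φ) =
      ((MpPsi.toRep (localSchrodinger F N T v)).comp s₂) g (M Φ))
    (J₁ : Matrix (Fin 1) (Fin 1) E) (hJ₁ : J₁ 0 0 ≠ 0) (χ : localPi E c 1 J₁ v →* ℂˣ) :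
    AreIsomorphicRep
      (TwistedCoinv.rep
        (ρW := show Representation ℂ (localPi E c 1 J₁ v) (SchwartzBruhat (Fin N → v.adicCompletion F)) from
          ((MpPsi.toRep (localSchrodinger F N T v)).comp s₁).comp (localCenter E c N J J₁ hJ₁ v))
        χ ((MpPsi.toRep (localSchrodinger F N T v)).comp s₁)
        (fun g z => (show Commute g (localCenter E c N J J₁ hJ₁ v z) from
          localCenter_comm E c N J J₁ hJ₁ v z g).map ((MpPsi.toRep (localSchrodinger F N T v)).comp s₁)))
      (TwistedCoinv.rep
        (ρW := show Representation ℂ (localPi E c 1 J₁ v) (SchwartzBruhat (Fin N → v.adicCompletion F)) from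
          ((MpPsi.toRep (localSchrodinger F N T v)).comp s₂).comp (localCenter E c N J J₁ hJ₁ v))
        χ ((MpPsi.toRep (localSchrodinger F N T v)).comp s₂)
        (fun g z => (show Commute g (localCenter E c N J J₁ hJ₁ v z) from
          localCenter_comm E c N J J₁ hJ₁ v z g).map ((MpPsi.toRep (localSchrodinger F N T v)).comp s₂))) :=
  TwistedCoinv.exists_equivariant_of_equivariant ((MpPsi.toRep (localSchrodinger F N T v)).comp s₁)
    ((MpPsi.toRep (localSchrodinger F N T v)).comp s₂) (localCenter E c N J J₁ hJ₁ v) χ _ _ M hM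

omit [Algebra.IsQuadraticExtension F E] in
/-- **`Θ_{s₁}(χ) ≠ 0 ↔ Θ_{s₂}(χ) ≠ 0`** along an equivariant `M : ω_{s₁} ≃ ω_{s₂}`.
[cite: MoeglinVignerasWaldspurger1987, Chap. 3 I.1–I.3, IV.2] -/
theorem nontrivial_thetaCoinv_iff_of_equivariant (s₁ s₂ : localPi E c N J v →* LocalMp F N T v)
    (M : SchwartzBruhat (Fin N → v.adicCompletion F) ≃ₗ[ℂ] SchwartzBruhat (Fin N → v.adicCompletion F))
    (hM : ∀ g Φ, M (((MpPsi.toRep (localSchrodinger F N T v)).comp s₁) g Φ) =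
      ((MpPsi.toRep (localSchrodinger F N T v)).comp s₂) g (M Φ))
    (J₁ : Matrix (Fin 1) (Fin 1) E) (hJ₁ : J₁ 0 0 ≠ 0) (χ : localPi E c 1 J₁ v →* ℂˣ) :
    Nontrivial (TwistedCoinv.Coinv
      (show Representation ℂ (localPi E c 1 J₁ v) (SchwartzBruhat (Fin N → v.adicCompletion F)) from
        ((MpPsi.toRep (localSchrodinger F N T v)).comp s₁).comp (localCenter E c N J J₁ hJ₁ v)) χ) ↔
    Nontrivial (TwistedCoinv.Coinv
      (show Representation ℂ (localPi E c 1 J₁ v) (SchwartzBruhat (Fin N → v.adicCompletion F)) from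
        ((MpPsi.toRep (localSchrodinger F N T v)).comp s₂).comp (localCenter E c N J J₁ hJ₁ v)) χ) :=
  TwistedCoinv.nontrivial_coinv_iff_of_equivariant ((MpPsi.toRep (localSchrodinger F N T v)).comp s₁)
    ((MpPsi.toRep (localSchrodinger F N T v)).comp s₂) (localCenter E c N J J₁ hJ₁ v) χ M hM

include hTd in
/-- **[Liu2021, Lem. D.1 (3)] (⇐) in `ε`, READ AT THE TREE'S OBJECTS — two skew-hermitian lines of the SAME class give
ISOMORPHIC rank-one theta lifts**: for `δ₂ ⊗ 1 = x xᶜ (δ₁ ⊗ 1)` (`x ∈ E_vˣ`; = `LemD1.SameClass` of the representatives,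
`sameClass_eps_iff_exists`), every splitting `s₁ : U(J)(F_v) →* LocalMp F N T v` (meant: over `ι_{δ₁}`; then the transported
splitting `s₂ = lineTransportSplitting … s₁` is over `ι_{δ₂}`, `proj_lineTransportSplitting`), every hermitian line `J₁` and
every character `χ` of `U(J₁)(F_v) = E_v¹`: `Θ_{s₁}(χ) ≅ Θ_{s₂}(χ)` as representations of `U(J)(F_v)` (`AreIsomorphicRep`) —
the currency of `mvw_IV4_rankOne_irreducibleOrZero` / `rankOne_theta_lines_disjoint`, any rank `N`, any finite place `v`.
[cite: MoeglinVignerasWaldspurger1987, Chap. 2 II.1, Chap. 3 I.1–I.3; HarrisKudlaSweet1996, §1; Liu2021, App. D Lemma D.1 (3) (l. 5233)] -/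
theorem areIsomorphicRep_theta_lineTransportSplitting (x : (LocalRing E v)ˣ)
    (hx : algebraMap E (LocalRing E v) δ₂ = (x : LocalRing E v) * conjLocal E c v x * algebraMap E (LocalRing E v) δ₁)
    (s₁ : localPi E c N J v →* LocalMp F N T v)
    (J₁ : Matrix (Fin 1) (Fin 1) E) (hJ₁ : J₁ 0 0 ≠ 0) (χ : localPi E c 1 J₁ v →* ℂˣ) :
    AreIsomorphicRep
      (TwistedCoinv.rep
        (ρW := show Representation ℂ (localPi E c 1 J₁ v) (SchwartzBruhat (Fin N → v.adicCompletion F)) from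
          ((MpPsi.toRep (localSchrodinger F N T v)).comp s₁).comp (localCenter E c N J J₁ hJ₁ v))
        χ ((MpPsi.toRep (localSchrodinger F N T v)).comp s₁)
        (fun g z => (show Commute g (localCenter E c N J J₁ hJ₁ v z) from
          localCenter_comm E c N J J₁ hJ₁ v z g).map ((MpPsi.toRep (localSchrodinger F N T v)).comp s₁)))
      (TwistedCoinv.rep
        (ρW := show Representation ℂ (localPi E c 1 J₁ v) (SchwartzBruhat (Fin N → v.adicCompletion F)) from
          ((MpPsi.toRep (localSchrodinger F N T v)).comp
            (lineTransportSplitting E v c N hcδ₁ hδ₁ hd₁ hcδ₂ hδ₂ hd₂ x T hT hTd hx s₁)).comp (localCenter E c N J J₁ hJ₁ v))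
        χ ((MpPsi.toRep (localSchrodinger F N T v)).comp
            (lineTransportSplitting E v c N hcδ₁ hδ₁ hd₁ hcδ₂ hδ₂ hd₂ x T hT hTd hx s₁))
        (fun g z => (show Commute g (localCenter E c N J J₁ hJ₁ v z) from
          localCenter_comm E c N J J₁ hJ₁ v z g).map ((MpPsi.toRep (localSchrodinger F N T v)).comp
            (lineTransportSplitting E v c N hcδ₁ hδ₁ hd₁ hcδ₂ hδ₂ hd₂ x T hT hTd hx s₁)))) :=
  areIsomorphicRep_theta_of_equivariant E v c N T s₁ _ _
    (lineTransportOp_equivariant E v c N hcδ₁ hδ₁ hd₁ hcδ₂ hδ₂ hd₂ x T hT hTd hx s₁) J₁ hJ₁ χ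

include hTd in
/-- **… and `Θ_{s₁}(χ) ≠ 0 ↔ Θ_{s₂}(χ) ≠ 0`** for the transported splitting `s₂` (the `χ`-coinvariant spaces are
isomorphic along `M_x`). [cite: MoeglinVignerasWaldspurger1987, Chap. 3 I.1–I.3, IV.2] -/
theorem nontrivial_thetaCoinv_iff_lineTransportSplitting (x : (LocalRing E v)ˣ)
    (hx : algebraMap E (LocalRing E v) δ₂ = (x : LocalRing E v) * conjLocal E c v x * algebraMap E (LocalRing E v) δ₁)
    (s₁ : localPi E c N J v →* LocalMp F N T v)
    (J₁ : Matrix (Fin 1) (Fin 1) E) (hJ₁ : J₁ 0 0 ≠ 0) (χ : localPi E c 1 J₁ v →* ℂˣ) :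
    Nontrivial (TwistedCoinv.Coinv
      (show Representation ℂ (localPi E c 1 J₁ v) (SchwartzBruhat (Fin N → v.adicCompletion F)) from
        ((MpPsi.toRep (localSchrodinger F N T v)).comp s₁).comp (localCenter E c N J J₁ hJ₁ v)) χ) ↔
    Nontrivial (TwistedCoinv.Coinv
      (show Representation ℂ (localPi E c 1 J₁ v) (SchwartzBruhat (Fin N → v.adicCompletion F)) from
        ((MpPsi.toRep (localSchrodinger F N T v)).comp
          (lineTransportSplitting E v c N hcδ₁ hδ₁ hd₁ hcδ₂ hδ₂ hd₂ x T hT hTd hx s₁)).comp (localCenter E c N J J₁ hJ₁ v)) χ) :=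
  nontrivial_thetaCoinv_iff_of_equivariant E v c N T s₁ _ _
    (lineTransportOp_equivariant E v c N hcδ₁ hδ₁ hd₁ hcδ₂ hδ₂ hd₂ x T hT hTd hx s₁) J₁ hJ₁ χ

/-- **Consumer glue: the hypothesis `δ₂ ⊗ 1 = x xᶜ (δ₁ ⊗ 1)` IS `LemD1.SameClass` of the Step-1 representatives**
`ε₁ = LemD1OfPlace.eps E v hδ₁`, `ε₂ = LemD1OfPlace.eps E v hδ₂` of the standing data at `v` (READING L3′; the negation of the
class hypothesis of `rankOne_theta_lines_disjoint`, cf. `sameClass_eps_iff` there). [cite: Liu2021, App. D §D.1 Step 1 (l. 5217)] -/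
theorem sameClass_eps_iff_exists (hN : 2 ≤ N) (hJh : (J.map c)ᵀ = J) (hJdet : J.det ≠ 0) :
    LemD1.SameClass (S := LemD1OfPlace.standingData E v c N J hcδ₁ hδ₁ hN hJh hJdet)
        ⟨LemD1OfPlace.eps E v hδ₁, LemD1OfPlace.eps_mem_skew E v c N J hcδ₁ hδ₁ hN hJh hJdet⟩
        ⟨LemD1OfPlace.eps E v hδ₂, eps_mem_skew_of E v c N J hcδ₁ hδ₁ hN hJh hJdet hδ₂ hcδ₂⟩ ↔
      ∃ x : (LocalRing E v)ˣ,
        algebraMap E (LocalRing E v) δ₂ = (x : LocalRing E v) * conjLocal E c v x * algebraMap E (LocalRing E v) δ₁ := by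
  rw [sameClass_eps_iff E v c N J hcδ₁ hδ₁ hN hJh hJdet hδ₂ hcδ₂]
  refine exists_congr fun x => ?_
  rw [Units.ext_iff, Units.val_mul, Units.val_mul, Units.coe_map]
  rfl

end Headline

end Literature.RepresentationTheory.MoeglinVignerasWaldspurger1987

end
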